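import Mathlib
import Summits.Ventures.HodgeRepro.Tier4.Target
import Summits.Ventures.HodgeRepro.Tier4.Line3.Defs
import Summits.Ventures.HodgeRepro.Tier4.Line3.DefsLemmas
import Summits.Ventures.HodgeRepro.Tier4.Line3.HeckeEquivarianceLemmas
import Summits.Ventures.HodgeRepro.Tier4.Line3.TorusInvariance
import Summits.Ventures.HodgeRepro.Tier4.Line3.CoefInvariance
import Summits.Ventures.HodgeRepro.Tier4.Line3.MainClassReps
import Summits.Ventures.HodgeRepro.Tier4.Line3.ClassFibres
import Summits.Ventures.HodgeRepro.Tier4.Line3.ClassRegrouping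
import Summits.Ventures.HodgeRepro.Tier4.Line3.BaseClassWeight
import Summits.Ventures.HodgeRepro.Tier4.Line3.BallCoordLemmas
import Summits.Ventures.HodgeRepro.Tier4.Line3.IntegrableMajorant
import Summits.Ventures.HodgeRepro.Tier4.Line3.KernelIntegrable
import Summits.Ventures.HodgeRepro.Tier4.Line3.LocSScalarObstructionGen
import Summits.Ventures.HodgeRepro.Tier4.Line3.UnitCopyScaling
import Summits.Ventures.HodgeRepro.Tier4.Line3.UnitCopyPos
import Summits.Ventures.HodgeRepro.Tier4.Line3.UnitCopyTerm
import Summits.Ventures.HodgeRepro.Tier4.Line3.UnitCopyPos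

/-!
# Tier4/Line3/ScalarCopyClassSum — THE FAMILY-SUM IDENTITY: the orbital term of a per-slot scalar copy of the centre
is `(∫_𝔹 kernelScale · kernel) · Λ · gaussRatio · classSum(xm)` (t4-x2 g2; t4-plan-3 g3 S13557 cut (2))

Blind re-derivation cell `pub-hodge-repro`, Tier 4 «PROVE THE STEP» (README §9–§10), LINE L3, seat t4-x2 (reserve
wall-breaker, g2).  On t4-L3-p2 g2's `UnitCopyScaling` (p680022: `kernelScale`, `gaussRatio`, `coefQ_smul_family`,
`kernel_smul_family`) and `UnitCopyTerm` / `UnitCopyPos` (p680492 / p680774: `scaleLine`, `scaleLine_lines`,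
`orbitOf_scaleLine`, `gaussRatio_const_on_orbit`), and t4-L3-p1's class bookkeeping (`mainRep`, `mem_class_iff`,
`classOf_lines_mainRep`, `exists_torus_of_lines_eq`, `exists_inv_mem`).

## The identity

For a per-slot scalar `ε` (all `ε j ≠ 0`) with the slot symmetries `SlotScalarSymmetric D j (ε j) (lam j)` and
`Λ := lam 0 · lam 1 · conj (lam 2 · lam 3)`:

* the `Γ′`-classes of the orbit of `ε • xm` are in bijection with those of `xm` (`scaleMainClass`: the scalar descends
  to `Γ′`-classes, `classStep_scaleLine`, `scaleClass`);
* the class weights agree (`stabCard_smul_scalar`, `stabCard_mulVec_mem`, `stabCard_eq_of_lines_eq`: the stabiliser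
  of a line tuple is unchanged by the scalar, conjugated by `Γ′`, and depends on the line tuple only);
* the class coefficients are the exact multiples `Λ · gaussRatio ε xm · coefQ (mainRep xm c)`
  (`coefQ_mainRep_scale`: `coefQ_smul_family` + `gaussRatio_const_on_orbit` + the `Γ′`- and torus-invariance of `coefQ`);

hence **`classSum_smul_family : classSum D.cf γ (ε • xm) = Λ · gaussRatio ε xm · classSum D.cf γ xm`** and, through
L3.6a (`term_main_unfold_of_wedge` applied to the copy — its wedge is `τ₀(ε 0) τ₀(ε 1)` times the centre's) and
`kernel_smul_family`,
**`term_smul_family : term D.Φ D.cf K γ (orbitOf (lines (ε • xm))) = (∫ z in ball, kernelScale ε xm z · kernel D.Φ xm z) ·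
(Λ · gaussRatio ε xm · classSum D.cf γ xm)`**.

## What it buys (S13519 (2), S13557 (2))

The copy's term is the SAME class sum as the main term's (`term main = (∫ kernel xm) · classSum xm`) times an
`N`-INDEPENDENT factor `I_∞^ε · Λ · gaussRatio` — so the `remainder` clause of `LocMU`, restricted to the scalar copies of
the centre, is the `N`-free inequality `Σ_{ε ≠ 1} ‖I_∞^ε‖ · gaussRatio ε xm ≤ θ · Re I_∞` on the centre alone (the
Gaussian-count half of S13519 (2), on paper).  Nothing here asserts anything about the truth of (P); HC_CM is NOT proved
by anyone in this repository.
-/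

set_option autoImplicit false

noncomputable section

namespace Summit.Ventures.HodgeRepro.Tier4.Line3

open Summit.Ventures.HodgeRepro.Tier4
open Matrix MeasureTheory NumberField
open scoped ComplexConjugate

open scoped Classical

namespace T4Data

variable (X : T4Data)

/-! ### 1. Scaling by non-zero scalars is injective on line tuples -/

/-- A norm-one scalar is non-zero. -/
theorem ne_zero_of_torus {t : X.E} (ht : X.c t * t = 1) : t ≠ 0 := by
  intro h
  rw [h, mul_zero] at ht
  exact zero_ne_one ht

/-- `lines (ε • a) = lines (ε • b) ↔ lines a = lines b` for non-zero scalars `ε j`. -/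
theorem lines_smul_eq_iff (ε : Fin 4 → X.E) (hε : ∀ j, ε j ≠ 0) (a b : X.Tuple) :
    X.lines (fun j => ε j • a j) = X.lines (fun j => ε j • b j) ↔ X.lines a = X.lines b := by
  constructor
  · intro h
    funext j
    have hj : Quot.mk X.lineStep (ε j • a j) = Quot.mk X.lineStep (ε j • b j) := congrFun h j
    obtain ⟨t, ht, hts⟩ := HeckeEquivariance.lineStep_of_mk_eq X hj
    have hb : b j = t • a j := by
      have h1 : ε j • b j = ε j • (t • a j) := by rw [hts, smul_comm]
      exact smul_right_injective _ (hε j) h1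
    exact Quot.sound ⟨t, ht, hb⟩
  · intro h
    obtain ⟨t, ht, hb⟩ := X.exists_torus_of_lines_eq h
    have e : (fun j => ε j • b j) = fun j => t j • (ε j • a j) := by
      funext j
      rw [hb j, smul_comm]
    rw [e, X.lines_smul t ht]

/-! ### 2. The scalar descends to `Γ′`-classes -/

/-- A `Γ′`-step is preserved by the per-slot scalar (`scaleLine`). -/
theorem classStep_scaleLine (K : X.Level) (ε : Fin 4 → X.E) {w w' : X.LineTuple} (h : X.classStep K w w') :
    X.classStep K (X.scaleLine ε w) (X.scaleLine ε w') := by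
  obtain ⟨γ, hγ, rfl⟩ := h
  refine ⟨γ, hγ, ?_⟩
  rw [X.scaleLine_lines]
  obtain ⟨t, ht, hrep⟩ := X.exists_torus_rep_lines (fun j => ε j • X.rep w j)
  have e1 : X.rep (X.scaleLine ε w) = fun j => t j • (ε j • X.rep w j) := hrep
  rw [e1]
  have e2 : (fun j => γ *ᵥ (t j • (ε j • X.rep w j))) = fun j => t j • (ε j • (γ *ᵥ X.rep w j)) := by
    funext j
    rw [Matrix.mulVec_smul, Matrix.mulVec_smul]
  rw [e2, X.lines_smul t ht]

/-- The per-slot scalar on `Γ′`-classes. -/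
def scaleClass (K : X.Level) (ε : Fin 4 → X.E) : X.Class K → X.Class K :=
  Quot.lift (fun w => X.classOf K (X.scaleLine ε w)) (fun _ _ h => Quot.sound (X.classStep_scaleLine K ε h))

/-- `scaleClass` on the class of `w` is the class of `scaleLine ε w`. -/
theorem scaleClass_classOf (K : X.Level) (ε : Fin 4 → X.E) (w : X.LineTuple) :
    X.scaleClass K ε (X.classOf K w) = X.classOf K (X.scaleLine ε w) := rfl

/-- Every class is the class of its chosen representative. -/
theorem classOf_out (K : X.Level) (c : X.Class K) : X.classOf K (Quot.out c) = c := Quot.out_eq c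

/-- The inverse scalar undoes `scaleClass`. -/
theorem scaleClass_scaleClass_inv (K : X.Level) (ε : Fin 4 → X.E) (hε : ∀ j, ε j ≠ 0) (c : X.Class K) :
    X.scaleClass K (fun j => (ε j)⁻¹) (X.scaleClass K ε c) = c := by
  rw [← X.classOf_out K c, X.scaleClass_classOf, X.scaleClass_classOf, X.scaleLine_scaleLine_inv ε hε]

/-- The inverse scalar has non-zero entries. -/
theorem inv_ne_zero_of (ε : Fin 4 → X.E) (hε : ∀ j, ε j ≠ 0) : ∀ j, (ε j)⁻¹ ≠ 0 := fun j => inv_ne_zero (hε j)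

/-- The scalar and its inverse cancel on tuples. -/
theorem smul_inv_smul_tuple (ε : Fin 4 → X.E) (hε : ∀ j, ε j ≠ 0) (xm : X.Tuple) :
    (fun j => (ε j)⁻¹ • (fun j => ε j • xm j) j) = xm := by
  funext j
  simp only [smul_smul, inv_mul_cancel₀ (hε j), one_smul]

/-- The class of a main class under the scalar is a main class of the copy. -/
theorem scaleClass_mem_main (K : X.Level) (ε : Fin 4 → X.E) (xm : X.Tuple) (c : X.MainClass K xm) :
    X.orbitOf (Quot.out (X.scaleClass K ε c.1)) = X.orbitOf (X.lines (fun j => ε j • xm j)) := by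
  rw [← X.classOf_out K c.1, X.scaleClass_classOf, X.orbitOf_out_classOf]
  exact X.orbitOf_scaleLine ε xm c.2

/-- **THE CLASSES OF THE COPY ARE THE CLASSES OF THE CENTRE**: the per-slot scalar is a bijection
`MainClass K xm ≃ MainClass K (ε • xm)`. -/
def scaleMainClass (K : X.Level) (ε : Fin 4 → X.E) (hε : ∀ j, ε j ≠ 0) (xm : X.Tuple) :
    X.MainClass K xm ≃ X.MainClass K (fun j => ε j • xm j) where
  toFun c := ⟨X.scaleClass K ε c.1, X.scaleClass_mem_main K ε xm c⟩
  invFun c := ⟨X.scaleClass K (fun j => (ε j)⁻¹) c.1, by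
    have h := X.scaleClass_mem_main K (fun j => (ε j)⁻¹) (fun j => ε j • xm j) c
    rwa [X.smul_inv_smul_tuple ε hε xm] at h⟩
  left_inv c := by
    apply Subtype.ext
    exact X.scaleClass_scaleClass_inv K ε hε c.1
  right_inv c := by
    apply Subtype.ext
    have h := X.scaleClass_scaleClass_inv K (fun j => (ε j)⁻¹) (X.inv_ne_zero_of ε hε) c.1
    have e : (fun j => ((ε j)⁻¹)⁻¹) = ε := by funext j; exact inv_inv (ε j)
    rw [e] at h
    exact h

/-! ### 3. The stabiliser cardinalities -/

/-- `stabCard` depends only on the line tuple. -/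
theorem stabCard_eq_of_lines_eq (K : X.Level) {x x' : X.Tuple} (h : X.lines x = X.lines x') :
    X.stabCard K x = X.stabCard K x' := by
  unfold stabCard
  refine Nat.card_congr (Equiv.subtypeEquivRight fun γ => ?_)
  rw [X.lines_mulVec_of_lines_eq h γ, h]

/-- `stabCard` is unchanged by the per-slot scalar. -/
theorem stabCard_smul_scalar (K : X.Level) (ε : Fin 4 → X.E) (hε : ∀ j, ε j ≠ 0) (x : X.Tuple) :
    X.stabCard K (fun j => ε j • x j) = X.stabCard K x := by
  unfold stabCard
  refine Nat.card_congr (Equiv.subtypeEquivRight fun γ => ?_)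
  have e : (fun j => γ *ᵥ (fun j => ε j • x j) j) = fun j => ε j • (γ *ᵥ x j) := by
    funext j
    exact Matrix.mulVec_smul γ (ε j) (x j)
  rw [e, X.lines_smul_eq_iff ε hε]

/-- `stabCard` is unchanged by a `Γ′`-translate (conjugation of the stabiliser). -/
theorem stabCard_mulVec_mem (K : X.Level) {γ₁ : Matrix (Fin 3) (Fin 3) X.E} (hγ₁ : γ₁ ∈ K.1) (x : X.Tuple) :
    X.stabCard K (fun j => γ₁ *ᵥ x j) = X.stabCard K x := by
  obtain ⟨δ, hδ, hγδ, hδγ⟩ := exists_inv_mem K.2.1 hγ₁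
  unfold stabCard
  have hmulVec : ∀ (A B : Matrix (Fin 3) (Fin 3) X.E) (y : X.Tuple),
      (fun j => A *ᵥ (fun j => B *ᵥ y j) j) = fun j => (A * B) *ᵥ y j := by
    intro A B y
    funext j
    exact Matrix.mulVec_mulVec (y j) A B
  refine Nat.card_congr
    { toFun := fun γ => ⟨δ * γ.1 * γ₁, K.2.1.2.1 _ (K.2.1.2.1 _ hδ γ.1 γ.2.1) _ hγ₁, ?_⟩
      invFun := fun γ => ⟨γ₁ * γ.1 * δ, K.2.1.2.1 _ (K.2.1.2.1 _ hγ₁ γ.1 γ.2.1) _ hδ, ?_⟩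
      left_inv := ?_
      right_inv := ?_ }
  · -- `δ γ γ₁` stabilises the lines of `x`
    have h1 : X.lines (fun j => γ.1 *ᵥ (fun j => γ₁ *ᵥ x j) j) = X.lines (fun j => γ₁ *ᵥ x j) := γ.2.2
    have h2 := X.lines_mulVec_of_lines_eq h1 δ
    have eL : (fun j => δ *ᵥ (fun j => γ.1 *ᵥ (fun j => γ₁ *ᵥ x j) j) j) = fun j => (δ * γ.1 * γ₁) *ᵥ x j := by
      funext j
      simp only [Matrix.mulVec_mulVec, Matrix.mul_assoc]
    have eR : (fun j => δ *ᵥ (fun j => γ₁ *ᵥ x j) j) = x := by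
      funext j
      rw [Matrix.mulVec_mulVec, hδγ, Matrix.one_mulVec]
    rw [eL, eR] at h2
    exact h2
  · -- `γ₁ γ δ` stabilises the lines of `γ₁ x`
    have h1 : X.lines (fun j => γ.1 *ᵥ x j) = X.lines x := γ.2.2
    have h2 := X.lines_mulVec_of_lines_eq h1 γ₁
    rw [hmulVec] at h2
    have e : (fun j => (γ₁ * γ.1 * δ) *ᵥ (fun j => γ₁ *ᵥ x j) j) = fun j => (γ₁ * γ.1) *ᵥ x j := by
      funext j
      rw [Matrix.mulVec_mulVec, Matrix.mul_assoc, Matrix.mul_assoc, hδγ, Matrix.mul_one]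
    rw [e]
    exact h2
  · intro γ
    apply Subtype.ext
    show γ₁ * (δ * γ.1 * γ₁) * δ = γ.1
    calc γ₁ * (δ * γ.1 * γ₁) * δ = (γ₁ * δ) * γ.1 * (γ₁ * δ) := by noncomm_ring
      _ = γ.1 := by rw [hγδ, Matrix.one_mul, Matrix.mul_one]
  · intro γ
    apply Subtype.ext
    show δ * (γ₁ * γ.1 * δ) * γ₁ = γ.1
    calc δ * (γ₁ * γ.1 * δ) * γ₁ = (δ * γ₁) * γ.1 * (δ * γ₁) := by noncomm_ring
      _ = γ.1 := by rw [hδγ, Matrix.one_mul, Matrix.mul_one]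

/-! ### 4. The class representatives of the copy -/

/-- The chosen representative of the scaled class is, up to `Γ′` and the torus, the scaled representative:
`lines (mainRep (ε • xm) (scaleMainClass c)) = lines (δ • (ε • mainRep xm c))` for some `δ ∈ Γ′`. -/
theorem exists_lines_mainRep_scale (K : X.Level) (ε : Fin 4 → X.E) (hε : ∀ j, ε j ≠ 0) (xm : X.Tuple)
    (c : X.MainClass K xm) :
    ∃ δ ∈ K.1, X.lines (X.mainRep K (fun j => ε j • xm j) (X.scaleMainClass K ε hε xm c)) =
      X.lines (fun j => δ *ᵥ (ε j • X.mainRep K xm c j)) := by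
  set c' := X.scaleMainClass K ε hε xm c with hc'
  -- the scaled line tuple of the representative of `c` lies in the class `c'`
  have hmem : X.classOf K (X.scaleLine ε (X.lines (X.mainRep K xm c))) = c'.1 := by
    show X.classOf K (X.scaleLine ε (X.lines (X.mainRep K xm c))) = X.scaleClass K ε c.1
    rw [← X.scaleClass_classOf, X.classOf_lines_mainRep]
  obtain ⟨γ, hγ, hw⟩ := (X.mem_class_iff K (fun j => ε j • xm j) c' _).1 hmem
  obtain ⟨δ, hδ, hγδ, hδγ⟩ := exists_inv_mem K.2.1 hγ
  refine ⟨δ, hδ, ?_⟩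
  -- `scaleLine ε (lines (mainRep c)) = lines (ε • mainRep c)`
  rw [X.scaleLine_lines] at hw
  have h1 := X.lines_mulVec_of_lines_eq hw δ
  have e1 : (fun j => δ *ᵥ (fun j => γ *ᵥ X.mainRep K (fun j => ε j • xm j) c' j) j) =
      X.mainRep K (fun j => ε j • xm j) c' := by
    funext j
    rw [Matrix.mulVec_mulVec, hδγ, Matrix.one_mulVec]
  rw [e1] at h1
  exact h1.symm

/-- The Gaussian ratio is invariant under the torus on the base tuple. -/
theorem gaussRatio_smul_torus (ε : Fin 4 → X.E) (t : Fin 4 → X.E) (ht : ∀ j, X.c (t j) * t j = 1) (y : X.Tuple) :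
    X.gaussRatio ε (fun j => t j • y j) = X.gaussRatio ε y := by
  unfold gaussRatio
  refine Finset.prod_congr rfl fun j _ => ?_
  rw [smul_comm, X.gaussDef_smul (ht j), X.gaussDef_smul (ht j)]

/-- The Gaussian ratio at a main-class representative is the Gaussian ratio at the centre. -/
theorem gaussRatio_mainRep (ε : Fin 4 → X.E) (K : X.Level) (xm : X.Tuple) (c : X.MainClass K xm) :
    X.gaussRatio ε (X.mainRep K xm c) = X.gaussRatio ε xm := by
  have horb : X.orbitOf (X.lines (X.mainRep K xm c)) = X.orbitOf (X.lines xm) := by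
    rw [← X.orbitOf_out_classOf K (X.lines (X.mainRep K xm c)), X.classOf_lines_mainRep]
    exact c.2
  obtain ⟨t, ht, hrep⟩ := X.exists_torus_rep_lines (X.mainRep K xm c)
  have h := X.gaussRatio_const_on_orbit ε xm horb
  rw [hrep, X.gaussRatio_smul_torus ε t ht] at h
  exact h

/-- **THE CLASS COEFFICIENT OF THE COPY** is `Λ · gaussRatio ε xm` times the class coefficient of the centre. -/
theorem coefQ_mainRep_scale (D : X.ThetaData) (K : X.Level) (γ : X.Tr K) {ε : Fin 4 → X.E} (hε : ∀ j, ε j ≠ 0)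
    {lam : Fin 4 → ℂ} (hu : ∀ j, X.SlotScalarSymmetric D j (ε j) (lam j)) (xm : X.Tuple) (c : X.MainClass K xm) :
    X.coefQ D.cf γ (X.mainRep K (fun j => ε j • xm j) (X.scaleMainClass K ε hε xm c)) =
      lam 0 * lam 1 * conj (lam 2 * lam 3) * ((X.gaussRatio ε xm : ℂ) * X.coefQ D.cf γ (X.mainRep K xm c)) := by
  obtain ⟨δ, hδ, hl⟩ := X.exists_lines_mainRep_scale K ε hε xm c
  -- transport along the lines: `coefQ` depends only on the line tuple
  obtain ⟨t, ht, hx⟩ := X.exists_torus_of_lines_eq hl.symm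
  have e : X.mainRep K (fun j => ε j • xm j) (X.scaleMainClass K ε hε xm c) =
      fun j => t j • (δ *ᵥ (ε j • X.mainRep K xm c j)) := funext hx
  rw [e, X.coefQ_smul D.cf D.weight γ t ht, X.coefQ_mulVec_mem_of_thetaData D γ hδ,
    X.coefQ_smul_family D hu γ (X.mainRep K xm c)]
  -- the Gaussian ratio is constant on the main orbit
  rw [X.gaussRatio_mainRep ε K xm c]

/-- The class weight of the copy is the class weight of the centre. -/
theorem stabCard_mainRep_scale (K : X.Level) {ε : Fin 4 → X.E} (hε : ∀ j, ε j ≠ 0) (xm : X.Tuple)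
    (c : X.MainClass K xm) :
    X.stabCard K (X.mainRep K (fun j => ε j • xm j) (X.scaleMainClass K ε hε xm c)) =
      X.stabCard K (X.mainRep K xm c) := by
  obtain ⟨δ, hδ, hl⟩ := X.exists_lines_mainRep_scale K ε hε xm c
  rw [X.stabCard_eq_of_lines_eq K hl, X.stabCard_mulVec_mem K hδ, X.stabCard_smul_scalar K ε hε]

/-! ### 5. The class sum and the orbital term of the copy -/

/-- **THE CLASS SUM OF THE COPY**: `classSum (ε • xm) = Λ · gaussRatio ε xm · classSum xm`. -/
theorem classSum_smul_family (D : X.ThetaData) (K : X.Level) (γ : X.Tr K) {ε : Fin 4 → X.E} (hε : ∀ j, ε j ≠ 0)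
    {lam : Fin 4 → ℂ} (hu : ∀ j, X.SlotScalarSymmetric D j (ε j) (lam j)) (xm : X.Tuple) :
    X.classSum D.cf γ (fun j => ε j • xm j) =
      lam 0 * lam 1 * conj (lam 2 * lam 3) * ((X.gaussRatio ε xm : ℂ) * X.classSum D.cf γ xm) := by
  unfold classSum
  set y' : X.Tuple := fun j => ε j • xm j with hy'
  set f : X.MainClass K y' → ℂ := fun c' =>
    ((X.centerCard K : ℂ) / (X.stabCard K (X.mainRep K y' c') : ℂ)) * X.coefQ D.cf γ (X.mainRep K y' c') with hf
  have e1 : (∑' c', f c') = ∑' c, f (X.scaleMainClass K ε hε xm c) :=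
    ((X.scaleMainClass K ε hε xm).tsum_eq f).symm
  have e2 : ∀ c, f (X.scaleMainClass K ε hε xm c) =
      lam 0 * lam 1 * conj (lam 2 * lam 3) * ((X.gaussRatio ε xm : ℂ) *
        (((X.centerCard K : ℂ) / (X.stabCard K (X.mainRep K xm c) : ℂ)) * X.coefQ D.cf γ (X.mainRep K xm c))) := by
    intro c
    simp only [hf]
    rw [X.coefQ_mainRep_scale D K γ hε hu xm c, X.stabCard_mainRep_scale K hε xm c]
    ring
  show (∑' c', f c') = _
  rw [e1, tsum_congr e2, tsum_mul_left, tsum_mul_left]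

/-- The wedge of the copy is `τ₀(ε 0) τ₀(ε 1)` times the wedge of the centre. -/
theorem wedge_smul_ne (xm : X.Tuple) {ε : Fin 4 → X.E} (hε : ∀ j, ε j ≠ 0)
    (hab : X.ballCoord (xm 0) 0 * X.ballCoord (xm 1) 1 - X.ballCoord (xm 0) 1 * X.ballCoord (xm 1) 0 ≠ 0) :
    X.ballCoord (ε 0 • xm 0) 0 * X.ballCoord (ε 1 • xm 1) 1 -
      X.ballCoord (ε 0 • xm 0) 1 * X.ballCoord (ε 1 • xm 1) 0 ≠ 0 := by
  rw [X.ballCoord_smul, X.ballCoord_smul]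
  simp only [Pi.smul_apply, smul_eq_mul]
  have h0 : X.τ₀ (ε 0) ≠ 0 := (map_ne_zero X.τ₀).mpr (hε 0)
  have h1 : X.τ₀ (ε 1) ≠ 0 := (map_ne_zero X.τ₀).mpr (hε 1)
  have e : X.τ₀ (ε 0) * X.ballCoord (xm 0) 0 * (X.τ₀ (ε 1) * X.ballCoord (xm 1) 1) -
      X.τ₀ (ε 0) * X.ballCoord (xm 0) 1 * (X.τ₀ (ε 1) * X.ballCoord (xm 1) 0) =
      (X.τ₀ (ε 0) * X.τ₀ (ε 1)) * (X.ballCoord (xm 0) 0 * X.ballCoord (xm 1) 1 -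
        X.ballCoord (xm 0) 1 * X.ballCoord (xm 1) 0) := by ring
  rw [e]
  exact mul_ne_zero (mul_ne_zero h0 h1) hab

/-- **THE FAMILY-SUM IDENTITY.** Under the displayed BHC input (`hD`) and L3.2a (`h2`), the orbital term of the per-slot
scalar copy `ε • xm` of the centre is
`(∫_𝔹 kernelScale ε xm · kernel xm) · Λ · gaussRatio ε xm · classSum xm` — the main term's class sum times an
`N`-independent factor. -/
theorem term_smul_family (D : X.ThetaData) (K : X.Level) (γ : X.Tr K) {ε : Fin 4 → X.E} (hε : ∀ j, ε j ≠ 0)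
    {lam : Fin 4 → ℂ} (hu : ∀ j, X.SlotScalarSymmetric D j (ε j) (lam j)) (xm : X.Tuple)
    (hab : X.ballCoord (xm 0) 0 * X.ballCoord (xm 1) 1 - X.ballCoord (xm 0) 1 * X.ballCoord (xm 1) 0 ≠ 0)
    (hD : IsFundamentalDomainFor (ballActions X.τ₀ X.C K.1) (X.domain K))
    (h2 : (∀ z ∈ X.domain K, Summable (fun w : X.LineTuple => ‖X.summand D.Φ D.cf γ w z‖)) ∧
      IntegrableOn (fun z => ∑' w : X.LineTuple, ‖X.summand D.Φ D.cf γ w z‖) (X.domain K)) :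
    X.term D.Φ D.cf K γ (X.orbitOf (X.lines (fun j => ε j • xm j))) =
      (∫ z in ball, ((X.kernelScale ε xm z : ℝ) : ℂ) * X.kernel D.Φ xm z) *
        (lam 0 * lam 1 * conj (lam 2 * lam 3) * ((X.gaussRatio ε xm : ℂ) * X.classSum D.cf γ xm)) := by
  rw [X.term_main_unfold_of_wedge D (fun j => ε j • xm j) (X.wedge_smul_ne xm hε hab) K γ hD h2,
    X.classSum_smul_family D K γ hε hu xm]
  congr 1
  refine setIntegral_congr_fun HeckeEquivariance.isOpen_ball'.measurableSet fun z _ => ?_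
  exact X.kernel_smul_family D.Φ ε xm z

end T4Data

end Summit.Ventures.HodgeRepro.Tier4.Line3

end
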